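import Literature.Probability.Percolation.RandomMapChains
import HarnessLib

/-!
# A tail bound for processes that drop by one only at prescribed times (GM14 Lemma 6.9 ⇒ (6.31))

Grimmett–Manolescu, *Bond percolation on isoradial graphs* (PTRF 159 (2014) 273–327 =
arXiv:1204.0505), §6.3, end of the proof of Lemma 6.9: the record heights `(h^k_j)_j` of the
vertical transport satisfy (6.32)–(6.34) — along the track exchanges the record drops by at most
one, it does not drop unless it equals the level `j + 1` being exchanged, and when it does equal
it, it does not drop with conditional probability at least `2δ` given the current value. "It
remains to show that (6.32)–(6.34) imply the lemma. This may seem obvious, but, since the sequence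
`(h^k_j)_j` is not Markovian, some technical details are needed. […] We shall bound
(stochastically) the sequence `(h^k_j)_j` by a Markov chain […] `X_{j+1} = X_j` if `X_j ≠ j + 1`,
`P(X_{j+1} = x | X_j = j+1) = 2δ` if `x = j + 1`, `1 - 2δ` if `x = j`. By (6.32)–(6.34),
`P(h_{j+1} ≥ x | h_j = y) ≥ P(X_{j+1} ≥ x | X_j = z)` for `z ≤ y`"; the comparison of laws is
GM13 (Ann. Probab. 41) Lemma 3.8, whose proof uses only the conditional laws given the *current*
value, so that no Markov property of `(h_j)` is needed.

This file proves the resulting tail bound in a self-contained analytic form, for an arbitrary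
finite sequence `G_0, …, G_n` of `ℕ`-valued random variables on a probability space:

* `RandomMapChain.tailF θ u cs m` — the tail `P(X_end ≥ u | X = m)` of the comparison chain with
  the remaining critical values `cs` (backward recursion), `tailF_mono` (monotone in `m`),
  `tailF_nonneg`, `tailF_le_one`;
* **`RandomMapChain.tailF_mul_le_measureReal`** — if a.s. `G_{k+1} + 1 ≥ G_k`, a.s.
  `G_{k+1} ≥ G_k` unless `G_k = ℓ_k`, and `θ · P(G_k = ℓ_k) ≤ P(G_k = ℓ_k, G_{k+1} ≥ ℓ_k)` for
  every `k < n`, then `tailF θ u [ℓ_0, …, ℓ_{n-1}] m · P(G_0 = m) ≤ P(G_n ≥ u)` for all `u, m`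
  (proof: `k ↦ E[tailF θ u [ℓ_k, …] (G_k)]` is nondecreasing).

It also supplies two bookkeeping lemmas for chains of random maps (`RandomMapChains`):
`before_val_succ`, `chain_eq_step_before` (the state before step `k + 1` is the `k`-th map
applied to the state before step `k`) and **`map_before_prodMk`** — under `μ_0 ⊗ ν^{⊗ n}` the
pair (state before step `k`, `k`-th sample) has law `μ_k ⊗ ν` — through which the hypotheses
above are checked for such chains.

## References

* G. R. Grimmett, I. Manolescu, PTRF 159 (2014) 273–327, arXiv:1204.0505, §6.3 (end of the
  proof of Lemma 6.9, the chain `X_j`).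
* G. R. Grimmett, I. Manolescu, Ann. Probab. 41 (2013), arXiv:1105.5535, §3.3 Lemma 3.8.
-/

noncomputable section

namespace Literature.Probability.Percolation

namespace RandomMapChain

open MeasureTheory Set

/-! ### Chains of random maps: the step relation and the pair law -/

section Chains

variable {A S : Type*}

/-- **The state before step `k + 1` is the `k`-th map applied to the state before step `k`.** [folklore] -/
theorem before_val_succ (n : ℕ) (f : Fin n → A → S → A) (a : A) (u : Fin n → S) (k : ℕ) (hk : k + 1 < n) :
    before n f a u ⟨k + 1, hk⟩ =
      f ⟨k, Nat.lt_of_succ_lt hk⟩ (before n f a u ⟨k, Nat.lt_of_succ_lt hk⟩) (u ⟨k, Nat.lt_of_succ_lt hk⟩) := by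
  unfold before
  rw [chain_succ_last]
  rfl

/-- **The final state is the last map applied to the state before the last step.** [folklore] -/
theorem chain_eq_step_before (n : ℕ) (f : Fin (n + 1) → A → S → A) (a : A) (u : Fin (n + 1) → S) :
    chain (n + 1) f a u = f (Fin.last n) (before (n + 1) f a u (Fin.last n)) (u (Fin.last n)) := by
  rw [chain_succ_last]
  rfl

variable [MeasurableSpace A] [MeasurableSpace S]

/-- **The pair law along a chain of random maps**: if the `k`-th map sends `μ_k ⊗ ν` to
`μ_{k+1}`, then under `μ_0 ⊗ ν^{⊗ n}` the state before step `k` and the `k`-th sample are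
independent with laws `μ_k` and `ν`. [folklore] -/
theorem map_before_prodMk (ν : Measure S) [IsProbabilityMeasure ν] : ∀ (n : ℕ) (f : Fin n → A → S → A)
    (_hf : ∀ k, Measurable (Function.uncurry (f k))) (μ : Fin (n + 1) → Measure A)
    [∀ k, IsProbabilityMeasure (μ k)],
    (∀ k : Fin n, ((μ k.castSucc).prod ν).map (Function.uncurry (f k)) = μ k.succ) →
    ∀ k : Fin n, ((μ 0).prod (Measure.pi fun _ : Fin n => ν)).map
        (fun x : A × (Fin n → S) => (before n f x.1 x.2 k, x.2 k)) = (μ k.castSucc).prod ν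
  | 0, _, _, _, _, _, k => k.elim0
  | n + 1, f, hf, μ, _, hμ, k => by
    -- split off the first sample
    set e := MeasurableEquiv.piFinSuccAbove (fun _ : Fin (n + 1) => S) 0 with he
    have hep : MeasurePreserving e (Measure.pi fun _ : Fin (n + 1) => ν)
        (ν.prod (Measure.pi fun _ : Fin n => ν)) :=
      measurePreserving_piFinSuccAbove (fun _ : Fin (n + 1) => ν) 0
    have he_apply : ∀ u : Fin (n + 1) → S, e u = (u 0, fun k => u k.succ) := by
      intro u
      simp [he, MeasurableEquiv.piFinSuccAbove, Fin.insertNthEquiv]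
      rfl
    refine Fin.cases ?_ (fun k' => ?_) k
    · -- `k = 0`: the initial state and the first sample
      have hfac : (fun x : A × (Fin (n + 1) → S) => (before (n + 1) f x.1 x.2 0, x.2 0)) =
          (fun y : A × (S × (Fin n → S)) => (y.1, y.2.1)) ∘ Prod.map id e := by
        funext x; simp [he_apply]
      have hGm : Measurable fun y : A × (S × (Fin n → S)) => (y.1, y.2.1) :=
        measurable_fst.prodMk (measurable_fst.comp measurable_snd)
      rw [hfac, ← Measure.map_map hGm (measurable_id.prodMap e.measurable),
        ← Measure.map_prod_map _ _ measurable_id e.measurable, Measure.map_id, hep.map_eq]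
      -- the marginal of `ν ⊗ ν^{⊗ n}` on the first factor
      have h2 : (fun y : A × (S × (Fin n → S)) => (y.1, y.2.1)) = Prod.map id Prod.fst := by
        funext y; rfl
      rw [h2, ← Measure.map_prod_map _ _ measurable_id measurable_fst, Measure.map_id, Measure.map_fst_prod,
        measure_univ, one_smul]
      rfl
    · -- `k = k'.succ`: induction, after moving the first step into the initial law
      set f' : Fin n → A → S → A := fun i => f i.succ with hf'
      set G : A × (S × (Fin n → S)) → A × S :=
        fun y => (before n f' (f 0 y.1 y.2.1) y.2.2 k', y.2.2 k') with hG
      have hfac : (fun x : A × (Fin (n + 1) → S) => (before (n + 1) f x.1 x.2 k'.succ, x.2 k'.succ)) =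
          G ∘ Prod.map id e := by
        funext x
        simp [hG, he_apply, before_succ, hf']
      have hGm : Measurable G := by
        have h1 : Measurable fun y : A × (S × (Fin n → S)) => (f 0 y.1 y.2.1, y.2.2) :=
          ((hf 0).comp (measurable_fst.prodMk (measurable_fst.comp measurable_snd))).prodMk
            (measurable_snd.comp measurable_snd)
        have h2 := measurable_before n f' (fun i => hf i.succ) k'
        exact (h2.comp h1).prodMk ((measurable_pi_apply k').comp (measurable_snd.comp measurable_snd))
      rw [hfac, ← Measure.map_map hGm (measurable_id.prodMap e.measurable),
        ← Measure.map_prod_map _ _ measurable_id e.measurable, Measure.map_id, hep.map_eq]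
      -- `G` factors through the first step
      have hG2 : G = (fun z : A × (Fin n → S) => (before n f' z.1 z.2 k', z.2 k')) ∘
          (fun y : A × (S × (Fin n → S)) => (f 0 y.1 y.2.1, y.2.2)) := by
        funext y; rfl
      have hstep : ((μ 0).prod (ν.prod (Measure.pi fun _ : Fin n => ν))).map
          (fun y : A × (S × (Fin n → S)) => (f 0 y.1 y.2.1, y.2.2)) =
          (μ 1).prod (Measure.pi fun _ : Fin n => ν) := by
        have h0 := hμ 0
        simp only [Fin.castSucc_zero, Fin.succ_zero_eq_one] at h0
        rw [← Measure.prodAssoc_prod, show (fun y : A × (S × (Fin n → S)) => (f 0 y.1 y.2.1, y.2.2)) =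
            Prod.map (Function.uncurry (f 0)) id ∘ MeasurableEquiv.prodAssoc.symm from by
              funext y; rfl,
          ← Measure.map_map ((hf 0).prodMap measurable_id) MeasurableEquiv.prodAssoc.symm.measurable,
          MeasurableEquiv.map_symm_map, ← Measure.map_prod_map _ _ (hf 0) measurable_id, h0, Measure.map_id]
      have hm2 : Measurable fun z : A × (Fin n → S) => (before n f' z.1 z.2 k', z.2 k') :=
        (measurable_before n f' (fun i => hf i.succ) k').prodMk ((measurable_pi_apply k').comp measurable_snd)
      have hm1 : Measurable fun y : A × (S × (Fin n → S)) => (f 0 y.1 y.2.1, y.2.2) :=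
        ((hf 0).comp (measurable_fst.prodMk (measurable_fst.comp measurable_snd))).prodMk
          (measurable_snd.comp measurable_snd)
      rw [hG2, ← Measure.map_map hm2 hm1, hstep]
      have ih := map_before_prodMk ν n f' (fun i => hf i.succ) (fun i => μ i.succ) (fun i => ?_) k'
      · simpa using ih
      · have h := hμ i.succ
        rw [← Fin.succ_castSucc] at h
        exact h

end Chains

/-! ### The comparison chain: its tail function -/

/-- **The tail of the comparison chain** `P(X_end ≥ u | X_now = m)` for the remaining critical
values `cs`: at a step with critical value `c` the chain stays at `c` with probability `θ` and
drops to `c - 1` with probability `1 - θ` if it is at `c`, and does not move otherwise (GM14's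
`X_j`, with `2δ = θ`). [cite: GrimmettManolescu2014Isoradial, §6.3] -/
def tailF (θ : ℝ) (u : ℕ) : List ℕ → ℕ → ℝ
  | [], m => if u ≤ m then 1 else 0
  | c :: cs, m => if m = c then θ * tailF θ u cs m + (1 - θ) * tailF θ u cs (m - 1) else tailF θ u cs m

/-- `tailF` is between `0` and `1`. [folklore] -/
theorem tailF_mem_Icc {θ : ℝ} (hθ0 : 0 ≤ θ) (hθ1 : θ ≤ 1) (u : ℕ) : ∀ (cs : List ℕ) (m : ℕ), tailF θ u cs m ∈ Set.Icc (0 : ℝ) 1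
  | [], m => by unfold tailF; split_ifs <;> norm_num
  | c :: cs, m => by
    unfold tailF
    have h1 := tailF_mem_Icc hθ0 hθ1 u cs m
    have h2 := tailF_mem_Icc hθ0 hθ1 u cs (m - 1)
    split_ifs
    · constructor <;> nlinarith [h1.1, h1.2, h2.1, h2.2]
    · exact h1

/-- `tailF` is nonnegative. [folklore] -/
theorem tailF_nonneg {θ : ℝ} (hθ0 : 0 ≤ θ) (hθ1 : θ ≤ 1) (u : ℕ) (cs : List ℕ) (m : ℕ) : 0 ≤ tailF θ u cs m :=
  (tailF_mem_Icc hθ0 hθ1 u cs m).1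

/-- `tailF` is at most `1`. [folklore] -/
theorem tailF_le_one {θ : ℝ} (hθ0 : 0 ≤ θ) (hθ1 : θ ≤ 1) (u : ℕ) (cs : List ℕ) (m : ℕ) : tailF θ u cs m ≤ 1 :=
  (tailF_mem_Icc hθ0 hθ1 u cs m).2

/-- **`tailF` is nondecreasing in the current value** (the comparison chain is stochastically
monotone). [folklore] -/
theorem tailF_mono {θ : ℝ} (hθ0 : 0 ≤ θ) (hθ1 : θ ≤ 1) (u : ℕ) : ∀ (cs : List ℕ) (m : ℕ), tailF θ u cs m ≤ tailF θ u cs (m + 1)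
  | [], m => by
    by_cases h1 : u ≤ m
    · simp [tailF, h1, show u ≤ m + 1 by omega]
    · by_cases h2 : u ≤ m + 1 <;> simp [tailF, h1, h2]
  | c :: cs, m => by
    have ih := tailF_mono hθ0 hθ1 u cs
    have h1 := ih m
    have h0 : tailF θ u cs (m - 1) ≤ tailF θ u cs m := by
      rcases Nat.eq_zero_or_pos m with rfl | hm
      · exact le_rfl
      · have := ih (m - 1); rwa [Nat.sub_add_cancel hm] at this
    show tailF θ u (c :: cs) m ≤ tailF θ u (c :: cs) (m + 1)
    unfold tailF
    simp only [Nat.add_sub_cancel]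
    split_ifs with hm hm1
    · omega
    · nlinarith
    · nlinarith
    · exact h1

/-- Monotonicity of `tailF` between any two values. [folklore] -/
theorem tailF_le_of_le {θ : ℝ} (hθ0 : 0 ≤ θ) (hθ1 : θ ≤ 1) (u : ℕ) (cs : List ℕ) {m m' : ℕ} (h : m ≤ m') :
    tailF θ u cs m ≤ tailF θ u cs m' := by
  induction h with
  | refl => exact le_rfl
  | step _ ih => exact ih.trans (tailF_mono hθ0 hθ1 u cs _)

/-! ### The tail bound -/

section TailBound

variable {Ω : Type*} [MeasurableSpace Ω]

/-- The remaining critical values `[ℓ k, ℓ (k+1), …, ℓ (n-1)]`. [folklore] -/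
def tailSeq (ℓ : ℕ → ℕ) (n k : ℕ) : List ℕ := (List.range' k (n - k)).map ℓ

/-- Peeling off the next critical value. [folklore] -/
theorem tailSeq_eq_cons {ℓ : ℕ → ℕ} {n k : ℕ} (hk : k < n) : tailSeq ℓ n k = ℓ k :: tailSeq ℓ n (k + 1) := by
  unfold tailSeq
  rw [show n - k = (n - (k + 1)) + 1 by omega, List.range'_succ, List.map_cons]

/-- No critical value remains at the end. [folklore] -/
theorem tailSeq_self (ℓ : ℕ → ℕ) (n : ℕ) : tailSeq ℓ n n = [] := by simp [tailSeq]

/-- At the start all critical values remain. [folklore] -/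
theorem tailSeq_zero (ℓ : ℕ → ℕ) (n : ℕ) : tailSeq ℓ n 0 = (List.range n).map ℓ := by
  simp [tailSeq, List.range_eq_range']

/-- A function of an `ℕ`-valued random variable with values in `[0, 1]` is integrable. [folklore] -/
theorem integrable_comp_nat {P : Measure Ω} [IsFiniteMeasure P] {G : Ω → ℕ} (hG : Measurable G) {t : ℕ → ℝ}
    (ht : ∀ m, t m ∈ Set.Icc (0 : ℝ) 1) : Integrable (fun x => t (G x)) P := by
  have hm : Measurable fun x => t (G x) := (measurable_from_nat (f := t)).comp hG
  refine (integrable_const (1 : ℝ)).mono' hm.aestronglyMeasurable (ae_of_all _ fun x => ?_)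
  rw [Real.norm_eq_abs, abs_le]
  exact ⟨by linarith [(ht (G x)).1], (ht (G x)).2⟩

/-- **One step of the comparison** (GM13 Lemma 3.8 in analytic form): if a.s. `G' + 1 ≥ G`, a.s.
`G' ≥ G` unless `G = c`, and `θ P(G = c) ≤ P(G = c, G' ≥ c)`, then
`E[tailF (c :: cs) (G)] ≤ E[tailF cs (G')]`. [cite: GrimmettManolescuAOP2013, Lemma 3.8] -/
theorem integral_tailF_cons_le {P : Measure Ω} [IsProbabilityMeasure P] {θ : ℝ} (hθ0 : 0 ≤ θ) (hθ1 : θ ≤ 1)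
    (u : ℕ) (cs : List ℕ) (c : ℕ) {G G' : Ω → ℕ} (hG : Measurable G) (hG' : Measurable G')
    (hdrop : P {x | G' x + 1 < G x} = 0) (hkeep : P {x | G x ≠ c ∧ G' x < G x} = 0)
    (hgood : θ * P.real {x | G x = c} ≤ P.real {x | G x = c ∧ c ≤ G' x}) :
    ∫ x, tailF θ u (c :: cs) (G x) ∂P ≤ ∫ x, tailF θ u cs (G' x) ∂P := by
  set t := tailF θ u (c :: cs) with ht
  set t' := tailF θ u cs with ht'
  have htI := tailF_mem_Icc hθ0 hθ1 u (c :: cs)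
  have ht'I := tailF_mem_Icc hθ0 hθ1 u cs
  set d := t' c - t' (c - 1) with hd
  have hd0 : 0 ≤ d := by
    rw [hd, sub_nonneg]
    exact tailF_le_of_le hθ0 hθ1 u cs (Nat.sub_le c 1)
  -- the pointwise a.e. inequality
  have hA : MeasurableSet {x | G x = c ∧ c ≤ G' x} :=
    (hG (measurableSet_singleton c)).inter (measurableSet_le measurable_const hG')
  have hB : MeasurableSet {x | G x = c} := hG (measurableSet_singleton c)
  have hae : ∀ᵐ x ∂P, d * ({x | G x = c ∧ c ≤ G' x}.indicator (fun _ => (1 : ℝ)) x) - d * θ * ({x | G x = c}.indicator (fun _ => (1 : ℝ)) x)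
      ≤ t' (G' x) - t (G x) := by
    have h1 : ∀ᵐ x ∂P, ¬ (G' x + 1 < G x) := by
      rw [ae_iff]; simpa using hdrop
    have h2 : ∀ᵐ x ∂P, ¬ (G x ≠ c ∧ G' x < G x) := by
      rw [ae_iff]; simpa using hkeep
    filter_upwards [h1, h2] with x hx1 hx2
    by_cases hc : G x = c
    · -- the critical case
      have htc : t (G x) = θ * t' c + (1 - θ) * t' (c - 1) := by rw [ht, ht', hc]; simp [tailF]
      by_cases hge : c ≤ G' x
      · rw [Set.indicator_of_mem (show x ∈ {x | G x = c ∧ c ≤ G' x} from ⟨hc, hge⟩),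
          Set.indicator_of_mem (show x ∈ {x | G x = c} from hc), htc]
        have := tailF_le_of_le hθ0 hθ1 u cs hge
        rw [hd]; nlinarith
      · have hG'c : G' x = c - 1 := by omega
        rw [Set.indicator_of_notMem (show x ∉ {x | G x = c ∧ c ≤ G' x} from fun h => hge h.2),
          Set.indicator_of_mem (show x ∈ {x | G x = c} from hc), htc, hG'c]
        rw [hd]; nlinarith
    · -- not critical: no drop
      have hge : G x ≤ G' x := by
        by_contra hlt; exact hx2 ⟨hc, not_le.1 hlt⟩
      rw [Set.indicator_of_notMem (show x ∉ {x | G x = c ∧ c ≤ G' x} from fun h => hc h.1),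
        Set.indicator_of_notMem (show x ∉ {x | G x = c} from hc)]
      have htc : t (G x) = t' (G x) := by rw [ht, ht']; simp [tailF, hc]
      rw [htc]
      have := tailF_le_of_le hθ0 hθ1 u cs hge
      nlinarith
  -- integrate
  have hIt : Integrable (fun x => t (G x)) P := integrable_comp_nat hG htI
  have hIt' : Integrable (fun x => t' (G' x)) P := integrable_comp_nat hG' ht'I
  have hIA : Integrable ({x | G x = c ∧ c ≤ G' x}.indicator fun _ => (1 : ℝ)) P := (integrable_const _).indicator hA
  have hIB : Integrable ({x | G x = c}.indicator fun _ => (1 : ℝ)) P := (integrable_const _).indicator hB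
  have key := integral_mono_ae ((hIA.const_mul d).sub (hIB.const_mul (d * θ))) (hIt'.sub hIt) hae
  simp only [Pi.sub_apply] at key
  rw [integral_sub (hIA.const_mul d) (hIB.const_mul (d * θ)), integral_const_mul, integral_const_mul,
    integral_indicator_const _ hA, integral_indicator_const _ hB, integral_sub hIt' hIt] at key
  simp only [smul_eq_mul, mul_one] at key
  nlinarith

/-- **The tail bound** (GM14, end of the proof of Lemma 6.9 / GM13 Lemma 3.8 iterated): for
`ℕ`-valued random variables `G_0, …, G_n` such that for every `k < n`, a.s. `G_{k+1} + 1 ≥ G_k`,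
a.s. `G_{k+1} ≥ G_k` unless `G_k = ℓ_k`, and `θ P(G_k = ℓ_k) ≤ P(G_k = ℓ_k, G_{k+1} ≥ ℓ_k)`, one has
`tailF θ u [ℓ_0, …, ℓ_{n-1}] m · P(G_0 = m) ≤ P(G_n ≥ u)` for all `u, m`.
[cite: GrimmettManolescu2014Isoradial, §6.3 (Lemma 6.9)] -/
theorem tailF_mul_le_measureReal {P : Measure Ω} [IsProbabilityMeasure P] {θ : ℝ} (hθ0 : 0 ≤ θ) (hθ1 : θ ≤ 1)
    (n : ℕ) (G : ℕ → Ω → ℕ) (hG : ∀ k, Measurable (G k)) (ℓ : ℕ → ℕ)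
    (hdrop : ∀ k < n, P {x | G (k + 1) x + 1 < G k x} = 0)
    (hkeep : ∀ k < n, P {x | G k x ≠ ℓ k ∧ G (k + 1) x < G k x} = 0)
    (hgood : ∀ k < n, θ * P.real {x | G k x = ℓ k} ≤ P.real {x | G k x = ℓ k ∧ ℓ k ≤ G (k + 1) x})
    (u m : ℕ) : tailF θ u ((List.range n).map ℓ) m * P.real {x | G 0 x = m} ≤ P.real {x | u ≤ G n x} := by
  -- `Φ k = E[tailF (tailSeq k) (G k)]` is nondecreasing in `k`
  set Φ : ℕ → ℝ := fun k => ∫ x, tailF θ u (tailSeq ℓ n k) (G k x) ∂P with hΦ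
  have hstep : ∀ k < n, Φ k ≤ Φ (k + 1) := fun k hk => by
    simp only [hΦ]
    rw [tailSeq_eq_cons hk]
    exact integral_tailF_cons_le hθ0 hθ1 u _ _ (hG k) (hG (k + 1)) (hdrop k hk) (hkeep k hk) (hgood k hk)
  have hmono : ∀ k ≤ n, Φ 0 ≤ Φ k := by
    intro k hk
    induction k with
    | zero => exact le_rfl
    | succ k ih => exact (ih (by omega)).trans (hstep k (by omega))
  -- at the end: the indicator of `{u ≤ G n}`
  have hend : Φ n = P.real {x | u ≤ G n x} := by
    simp only [hΦ, tailSeq_self]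
    have : (fun x => tailF θ u [] (G n x)) = {x | u ≤ G n x}.indicator fun _ => (1 : ℝ) := by
      funext x
      simp only [tailF, Set.indicator_apply, Set.mem_setOf_eq]
    rw [this, integral_indicator_const _ (measurableSet_le measurable_const (hG n)), smul_eq_mul, mul_one]
  -- at the start: at least the contribution of `{G 0 = m}`
  have hstart : tailF θ u ((List.range n).map ℓ) m * P.real {x | G 0 x = m} ≤ Φ 0 := by
    simp only [hΦ, tailSeq_zero]
    have hB : MeasurableSet {x | G 0 x = m} := hG 0 (measurableSet_singleton m)
    have h1 : tailF θ u ((List.range n).map ℓ) m * P.real {x | G 0 x = m} =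
        ∫ x, {x | G 0 x = m}.indicator (fun _ => tailF θ u ((List.range n).map ℓ) m) x ∂P := by
      rw [integral_indicator_const _ hB, smul_eq_mul, mul_comm]
    rw [h1]
    refine integral_mono ((integrable_const _).indicator hB)
      (integrable_comp_nat (hG 0) (tailF_mem_Icc hθ0 hθ1 u _)) fun x => ?_
    by_cases hx : x ∈ {x | G 0 x = m}
    · rw [Set.indicator_of_mem hx]
      have : G 0 x = m := hx
      rw [this]
    · rw [Set.indicator_of_notMem hx]
      exact tailF_nonneg hθ0 hθ1 u _ _
  calc tailF θ u ((List.range n).map ℓ) m * P.real {x | G 0 x = m} ≤ Φ 0 := hstart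
    _ ≤ Φ n := hmono n le_rfl
    _ = P.real {x | u ≤ G n x} := hend

end TailBound

end RandomMapChain

end Literature.Probability.Percolation
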